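import Literature.Computability.Complexity.RandomizingPolynomialsMatrix
import Mathlib.Algebra.BigOperators.Fin
import Mathlib.Data.List.GetD
import HarnessLib

/-!
# Randomizing polynomials III: the degree-3 block of a monomial (sparse polynomials over `F₂`)

The Ishai–Kushilevitz randomization `R₁ · L(x, ρ) · R₂` of the path matrix of a monomial
`x_{T₀} ⋯ x_{T_d}` plus an affine part `ρ` (files I–II), written out as SPARSE POLYNOMIALS with
ℕ-indexed variables: the `(d+1)(d+2)/2` entries on and above the diagonal, each a list of monomials
of length `≤ 3` in the original variables and `d(d+1)/2 + d` fresh variables (the entries of `R₁`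
above the diagonal and of `R₂` in the last column), numbered contiguously from a counter `n₀` by the
triangular enumeration `pos i k = tri k + i` of pairs `i ≤ k`.

* `evalP`, `evalM` (values of sparse polynomials / maps at a valuation `v : ℕ → ZMod 2`), `mulP`;
* `tri`, `pos`, `pairsLE`; the symbolic matrices `symR1`, `symL`, `symR2`, the output `entry`, the
  block `ikBlock n₀ T ρ`;
* `evalP_entry`: the value of an entry is the matrix entry of
  `matR1 v * pathMat (xsOf d T v) (rhoOf ρ v) * matR2 v` (file I), `evalM_ikBlock_eq_iff`;
  `pos_inj` / `exists_pos_eq` (the numbering is a bijection onto the fresh block).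

Not here: degree / support of the block and its perfect-extension property (file IV), the encoding
of whole polynomials and maps (file V), entropy (file VI), polynomial time (file VII).

## References

* Y. Ishai, E. Kushilevitz, ICALP 2002, §3; B. Applebaum, Y. Ishai, E. Kushilevitz, SIAM J. Comput.
  36 (2006), §4; Z. Dvir, D. Gutfreund, G. Rothblum, S. Vadhan, ECCC TR10-160, Thm 4.5.
-/

namespace Literature.Computability.Complexity

namespace RandPoly

open Matrix Finset

/-! ### Sparse polynomials over `F₂` with ℕ-indexed variables -/

/-- Value at a valuation `v : ℕ → F₂` of a sparse polynomial (a list of monomials, each a list of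
variable indices; value = sum over the monomials of the product of the listed variables).
[cite: DvirGutfreundRothblumVadhan2010, §2] -/
def evalP (v : ℕ → ZMod 2) (p : List (List ℕ)) : ZMod 2 := (p.map fun μ => (μ.map v).prod).sum

/-- Value of a sparse polynomial map (list of polynomials). [cite: DvirGutfreundRothblumVadhan2010, §2] -/
def evalM (v : ℕ → ZMod 2) (P : List (List (List ℕ))) : List (ZMod 2) := P.map (evalP v)

/-- Product of sparse polynomials: concatenate monomials pairwise. [folklore] -/
def mulP (p q : List (List ℕ)) : List (List ℕ) := p.flatMap fun μ => q.map fun ν => μ ++ ν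

variable {v w : ℕ → ZMod 2}

/-- Value of the empty polynomial. [folklore] -/
@[simp] theorem evalP_nil : evalP v [] = 0 := rfl

/-- Value of a polynomial with a first monomial. [folklore] -/
@[simp] theorem evalP_cons (μ : List ℕ) (p : List (List ℕ)) :
    evalP v (μ :: p) = (μ.map v).prod + evalP v p := by
  simp [evalP]

/-- Value of a concatenation (sum of polynomials). [folklore] -/
theorem evalP_append (p q : List (List ℕ)) : evalP v (p ++ q) = evalP v p + evalP v q := by
  simp [evalP, List.sum_append]

/-- Value of the one-monomial polynomial. [folklore] -/
theorem evalP_singleton (μ : List ℕ) : evalP v [μ] = (μ.map v).prod := by simp [evalP]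

/-- Value of a `flatMap` (sum over a list of polynomials). [folklore] -/
theorem evalP_flatMap {α : Type} (l : List α) (f : α → List (List ℕ)) :
    evalP v (l.flatMap f) = (l.map fun a => evalP v (f a)).sum := by
  induction l with
  | nil => rfl
  | cons a l ih => rw [List.flatMap_cons, evalP_append, ih, List.map_cons, List.sum_cons]

/-- Value of a monomial multiple of a polynomial. [folklore] -/
theorem evalP_map_append (μ : List ℕ) (q : List (List ℕ)) :
    evalP v (q.map fun ν => μ ++ ν) = (μ.map v).prod * evalP v q := by
  induction q with
  | nil => simp [evalP]
  | cons ν q ihq =>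
    rw [List.map_cons, evalP_cons, evalP_cons, ihq, mul_add, List.map_append, List.prod_append]

/-- Value of a product. [folklore] -/
theorem evalP_mulP (p q : List (List ℕ)) : evalP v (mulP p q) = evalP v p * evalP v q := by
  induction p with
  | nil => simp [mulP, evalP]
  | cons μ p ih =>
    have : mulP (μ :: p) q = (q.map fun ν => μ ++ ν) ++ mulP p q := rfl
    rw [this, evalP_append, ih, evalP_cons, add_mul, evalP_map_append]

/-- The value depends only on the variables that occur. [folklore] -/
theorem evalP_congr {p : List (List ℕ)} (h : ∀ μ ∈ p, ∀ i ∈ μ, v i = w i) : evalP v p = evalP w p := by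
  unfold evalP
  congr 1
  refine List.map_congr_left fun μ hμ => ?_
  rw [List.map_congr_left (h μ hμ)]

/-- The value of a map depends only on the variables that occur. [folklore] -/
theorem evalM_congr {P : List (List (List ℕ))} (h : ∀ p ∈ P, ∀ μ ∈ p, ∀ i ∈ μ, v i = w i) :
    evalM v P = evalM w P :=
  List.map_congr_left fun p hp => evalP_congr (h p hp)

/-- Values of maps are computed coordinatewise. [folklore] -/
theorem evalM_append (P Q : List (List (List ℕ))) : evalM v (P ++ Q) = evalM v P ++ evalM v Q := by
  simp [evalM]

/-- Length of the value of a map. [folklore] -/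
@[simp] theorem length_evalM (P : List (List (List ℕ))) : (evalM v P).length = P.length := by
  simp [evalM]

/-- Equality of values of a concatenation. [folklore] -/
theorem evalM_append_inj {P Q : List (List (List ℕ))} :
    evalM v (P ++ Q) = evalM w (P ++ Q) ↔ evalM v P = evalM w P ∧ evalM v Q = evalM w Q := by
  rw [evalM_append, evalM_append]
  constructor
  · intro h; exact List.append_inj h (by simp)
  · rintro ⟨h1, h2⟩; rw [h1, h2]

/-- List sums over `range` are `Finset` sums. [folklore] -/
theorem sum_map_range {M : Type*} [AddCommMonoid M] (m : ℕ) (f : ℕ → M) :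
    ((List.range m).map f).sum = ∑ j ∈ Finset.range m, f j := by
  induction m with
  | zero => simp
  | succ m ih => rw [List.range_succ, List.map_append, List.sum_append, ih, Finset.sum_range_succ]; simp

/-! ### The triangular numbering of pairs `i ≤ k` -/

/-- Triangular numbers, recursively: `tri k = k(k+1)/2` = number of pairs `i ≤ k' < k`. [folklore] -/
def tri : ℕ → ℕ
  | 0 => 0
  | k + 1 => tri k + (k + 1)

/-- Position of the pair `(i, k)`, `i ≤ k`, in the enumeration by columns. [folklore] -/
def pos (i k : ℕ) : ℕ := tri k + i

/-- The pairs `i ≤ k ≤ d`, row by row. [folklore] -/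
def pairsLE (d : ℕ) : List (ℕ × ℕ) :=
  (List.range (d + 1)).flatMap fun i => ((List.range (d + 1)).filter fun k => i ≤ k).map fun k => (i, k)

/-- `tri` is monotone. [folklore] -/
theorem tri_mono {a b : ℕ} (h : a ≤ b) : tri a ≤ tri b := by
  induction h with
  | refl => exact le_rfl
  | step _ ih => exact ih.trans (by simp [tri])

/-- `tri k = k (k+1) / 2`. [folklore] -/
theorem tri_eq (k : ℕ) : tri k = k * (k + 1) / 2 := by
  induction k with
  | zero => rfl
  | succ k ih =>
    rw [tri, ih]
    have : (k + 1) * (k + 1 + 1) = k * (k + 1) + 2 * (k + 1) := by ring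
    rw [this, Nat.add_mul_div_left _ _ (by norm_num)]

/-- **`pos` is injective on pairs `i ≤ k`.** [folklore] -/
theorem pos_inj {i k i' k' : ℕ} (hik : i ≤ k) (hik' : i' ≤ k') (h : pos i k = pos i' k') :
    i = i' ∧ k = k' := by
  have hk : k = k' := by
    by_contra hne
    rcases lt_or_gt_of_ne hne with hlt | hlt
    · have : pos i k < pos i' k' :=
        calc pos i k < tri (k + 1) := by simp [pos, tri]; omega
          _ ≤ tri k' := tri_mono hlt
          _ ≤ pos i' k' := Nat.le_add_right _ _
      omega
    · have : pos i' k' < pos i k :=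
        calc pos i' k' < tri (k' + 1) := by simp [pos, tri]; omega
          _ ≤ tri k := tri_mono hlt
          _ ≤ pos i k := Nat.le_add_right _ _
      omega
  subst hk
  exact ⟨by unfold pos at h; omega, rfl⟩

/-- **Every offset below `pos d d` is the position of a pair `i ≤ k ≤ d` other than `(d, d)`**
(`i < k`, an `R₁`-variable, or `i = k < d`, an `R₂`-variable). [folklore] -/
theorem exists_pos_eq {d m : ℕ} (hm : m < pos d d) :
    ∃ i k, i ≤ k ∧ k ≤ d ∧ (i < k ∨ k < d) ∧ pos i k = m := by
  induction d with
  | zero => simp [pos, tri] at hm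
  | succ d ih =>
    by_cases h : m < pos d d
    · obtain ⟨i, k, hik, hkd, hor, rfl⟩ := ih h
      exact ⟨i, k, hik, Nat.le_succ_of_le hkd, Or.inr (Nat.lt_succ_of_le hkd), rfl⟩
    · -- `m ∈ [pos d d, pos (d+1) (d+1))`: either `(d, d)` or `(i, d+1)` with `i ≤ d`
      rw [not_lt] at h
      by_cases h' : m = pos d d
      · exact ⟨d, d, le_rfl, Nat.le_succ d, Or.inr (Nat.lt_succ_self d), h'.symm⟩
      · refine ⟨m - tri (d + 1), d + 1, ?_, le_rfl, Or.inl ?_, ?_⟩ <;>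
          simp only [pos, tri] at hm h h' ⊢ <;> omega

/-- Membership in `pairsLE`. [folklore] -/
theorem mem_pairsLE {d : ℕ} {ik : ℕ × ℕ} : ik ∈ pairsLE d ↔ ik.1 ≤ ik.2 ∧ ik.2 ≤ d := by
  obtain ⟨i, k⟩ := ik
  simp only [pairsLE, List.mem_flatMap, List.mem_range, List.mem_map, List.mem_filter,
    decide_eq_true_eq, Prod.mk.injEq]
  constructor
  · rintro ⟨i', hi', k', ⟨hk', hik'⟩, rfl, rfl⟩; omega
  · rintro ⟨hik, hkd⟩; exact ⟨i, by omega, k, ⟨by omega, hik⟩, rfl, rfl⟩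

/-! ### The symbolic block -/

/-- Entry `(i, j)` of the symbolic randomizer `R₁` (upper unitriangular with fresh variables
`n₀ + pos i j` above the diagonal). [cite: IshaiKushilevitz2002, §3] -/
def symR1 (n₀ i j : ℕ) : List (List ℕ) :=
  if i = j then [[]] else if i < j then [[n₀ + pos i j]] else []

/-- Entry `(j, l)` of the symbolic path matrix of the monomial `T` (variables `T₀, …, T_d` on the
diagonal, `1` on the subdiagonal, the affine part `ρ` in the corner `(0, d)`).
[cite: IshaiKushilevitz2002, §3] -/
def symL (T ρ : List ℕ) (d j l : ℕ) : List (List ℕ) :=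
  (if j = l then [[T.getD j 0]] else []) ++ (if j = l + 1 then [[]] else []) ++
    (if j = 0 ∧ l = d then ρ.map (fun r => [r]) else [])

/-- Entry `(l, k)` of the symbolic randomizer `R₂` (identity plus fresh variables `n₀ + pos l l`,
`l < d`, in the last column). [cite: IshaiKushilevitz2002, §3] -/
def symR2 (n₀ d l k : ℕ) : List (List ℕ) :=
  (if l = k then [[]] else []) ++ (if k = d ∧ l < d then [[n₀ + pos l l]] else [])

/-- Entry `(i, k)` of the symbolic product `R₁ · L · R₂`: a sparse polynomial of degree `≤ 3`.
[cite: IshaiKushilevitz2002, §3] -/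
def entry (n₀ : ℕ) (T ρ : List ℕ) (d i k : ℕ) : List (List ℕ) :=
  (List.range (d + 1)).flatMap fun j => (List.range (d + 1)).flatMap fun l =>
    mulP (mulP (symR1 n₀ i j) (symL T ρ d j l)) (symR2 n₀ d l k)

/-- **The degree-3 block of the monomial `T` with affine part `ρ`**: the entries `(i, k)`, `i ≤ k ≤ d`
(`d = |T| - 1`), of `R₁ · L · R₂`, with fresh variables numbered from `n₀`.  (`T = []` is never used.)
[cite: IshaiKushilevitz2002, §3] -/
def ikBlock (n₀ : ℕ) (T ρ : List ℕ) : List (List (List ℕ)) :=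
  (pairsLE (T.length - 1)).map fun ik => entry n₀ T ρ (T.length - 1) ik.1 ik.2

/-! ### Values: the block evaluates to the matrix product of files I–II -/

variable {d : ℕ}

/-- The randomizer `R₁` read off a valuation. [cite: IshaiKushilevitz2002, §3] -/
def matR1 (n₀ d : ℕ) (v : ℕ → ZMod 2) : Mat d :=
  Matrix.of fun i j : Fin (d + 1) => if i = j then 1 else if i < j then v (n₀ + pos i.val j.val) else 0

/-- The randomizer `R₂` read off a valuation. [cite: IshaiKushilevitz2002, §3] -/
def matR2 (n₀ d : ℕ) (v : ℕ → ZMod 2) : Mat d :=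
  Matrix.of fun l k : Fin (d + 1) =>
    (if l = k then 1 else 0) + (if k = Fin.last d ∧ l ≠ Fin.last d then v (n₀ + pos l.val l.val) else 0)

/-- The values of the variables of the monomial `T`. [folklore] -/
def xsOf (d : ℕ) (T : List ℕ) (v : ℕ → ZMod 2) : Fin (d + 1) → ZMod 2 := fun j => v (T.getD j.val 0)

/-- The value of the affine part `ρ`. [folklore] -/
def rhoOf (ρ : List ℕ) (v : ℕ → ZMod 2) : ZMod 2 := (ρ.map v).sum

/-- `R₁(v)` is upper unitriangular. [folklore] -/
theorem matR1_isUnitri (n₀ d : ℕ) (v : ℕ → ZMod 2) : IsUnitri (matR1 n₀ d v) := by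
  refine ⟨fun i => by simp [matR1], fun i j hji => ?_⟩
  have h1 : i ≠ j := fun h => by rw [h] at hji; exact lt_irrefl _ hji
  simp [matR1, h1, not_lt.2 (le_of_lt hji)]

/-- `R₂(v)` is a last-column matrix. [folklore] -/
theorem matR2_isLastCol (n₀ d : ℕ) (v : ℕ → ZMod 2) : IsLastCol (matR2 n₀ d v) := by
  refine ⟨fun i => ?_, fun i j hij hj => ?_⟩
  · simp only [matR2, of_apply, if_true]
    split_ifs with h
    · exact absurd h.1 h.2
    · rw [add_zero]
  · simp [matR2, hij, hj]

/-- Value of the affine part as a polynomial. [folklore] -/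
theorem evalP_map_singleton (ρ : List ℕ) : evalP v (ρ.map fun r => [r]) = rhoOf ρ v := by
  induction ρ with
  | nil => rfl
  | cons r ρ ih => rw [List.map_cons, evalP_cons, ih]; simp [rhoOf]

/-- Value of a symbolic `R₁` entry. [folklore] -/
theorem evalP_symR1 (n₀ : ℕ) (i j : Fin (d + 1)) :
    evalP v (symR1 n₀ i.val j.val) = matR1 n₀ d v i j := by
  simp only [symR1, matR1, of_apply, Fin.val_inj, Fin.lt_def]
  split_ifs <;> simp [evalP]

/-- Value of a symbolic path-matrix entry. [folklore] -/
theorem evalP_symL (T ρ : List ℕ) (j l : Fin (d + 1)) :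
    evalP v (symL T ρ d j.val l.val) = pathMat (xsOf d T v) (rhoOf ρ v) j l := by
  simp only [symL, pathMat, of_apply, evalP_append, Fin.val_inj, xsOf]
  have hl : (l.val = d) ↔ (l = Fin.last d) := by
    rw [Fin.ext_iff, Fin.val_last]
  have hj : (j.val = 0) ↔ (j = 0) := by rw [Fin.ext_iff, Fin.val_zero]
  congr 1; congr 1
  · split_ifs <;> simp [evalP]
  · split_ifs <;> simp [evalP]
  · simp only [hl, hj]
    split_ifs <;> simp [evalP_map_singleton]

/-- Value of a symbolic `R₂` entry. [folklore] -/
theorem evalP_symR2 (n₀ : ℕ) (l k : Fin (d + 1)) :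
    evalP v (symR2 n₀ d l.val k.val) = matR2 n₀ d v l k := by
  simp only [symR2, matR2, of_apply, evalP_append, Fin.val_inj]
  have hk : (k.val = d) ↔ (k = Fin.last d) := by rw [Fin.ext_iff, Fin.val_last]
  have hl : (l.val < d) ↔ (l ≠ Fin.last d) := by
    rw [Ne, Fin.ext_iff, Fin.val_last]; have := l.isLt; omega
  simp only [hk, hl]
  congr 1 <;> split_ifs <;> simp [evalP]

/-- **The entries evaluate to the entries of `R₁ · L · R₂`.** [cite: IshaiKushilevitz2002, §3] -/
theorem evalP_entry (n₀ : ℕ) (T ρ : List ℕ) (i k : Fin (d + 1)) :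
    evalP v (entry n₀ T ρ d i.val k.val) =
      (matR1 n₀ d v * pathMat (xsOf d T v) (rhoOf ρ v) * matR2 n₀ d v) i k := by
  rw [entry, evalP_flatMap, sum_map_range, Finset.sum_range, Matrix.mul_apply]
  simp_rw [evalP_flatMap, sum_map_range, Finset.sum_range, evalP_mulP, Matrix.mul_apply,
    Finset.sum_mul]
  rw [Finset.sum_comm]
  refine Finset.sum_congr rfl fun l _ => Finset.sum_congr rfl fun j _ => ?_
  rw [evalP_symR1, evalP_symL, evalP_symR2]

/-- **Equality of the values of two blocks is equality of the projections of the matrix products.**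
[cite: IshaiKushilevitz2002, §3] -/
theorem evalM_ikBlock_eq_iff (n₀ : ℕ) {T : List ℕ} (hT : T.length = d + 1) (ρ : List ℕ)
    (v w : ℕ → ZMod 2) :
    evalM v (ikBlock n₀ T ρ) = evalM w (ikBlock n₀ T ρ) ↔
      ∀ i k : Fin (d + 1), i ≤ k →
        (matR1 n₀ d v * pathMat (xsOf d T v) (rhoOf ρ v) * matR2 n₀ d v) i k =
          (matR1 n₀ d w * pathMat (xsOf d T w) (rhoOf ρ w) * matR2 n₀ d w) i k := by
  have hd : T.length - 1 = d := by omega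
  simp only [ikBlock, evalM, List.map_map, hd]
  rw [List.map_inj_left]
  constructor
  · intro h i k hik
    have := h (i.val, k.val) (mem_pairsLE.2 ⟨hik, Nat.le_of_lt_succ k.isLt⟩)
    simpa only [Function.comp_apply, evalP_entry] using this
  · rintro h ⟨i, k⟩ hik
    obtain ⟨hik, hkd⟩ := mem_pairsLE.1 hik
    have hi : i < d + 1 := by simp only at hik hkd; omega
    have hk : k < d + 1 := by simp only at hkd; omega
    have h1 := h ⟨i, hi⟩ ⟨k, hk⟩ hik
    rw [← evalP_entry, ← evalP_entry] at h1
    exact h1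

end RandPoly

end Literature.Computability.Complexity
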